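import Mathlib
import Summits.Parity.BatemanHorn.Theses.PolynomialMobius
import Summits.Parity.BatemanHorn.Theses.IsogenyRedei
import Summits.Parity.BatemanHorn.Theorems.PolynomialMobiusPolyMobiusTailCoreExact
import Summits.Parity.BatemanHorn.Theorems.PolynomialMobiusPolyMobiusTailStubNonlinearWindowOfLevel
import Summits.Parity.BatemanHorn.Theorems.PolynomialMobiusPolyMobiusTailSummitEquivalence
import Summits.Parity.BatemanHorn.Theorems.PolynomialMobiusPolyMobiusTailStubPairCorner

/-!
# Crux stmt-Parity-0870 `PolyMobiusTail` — line `window-three-corner` (forward ladder G4, rung k = 2 → 3)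

Planner `planner-fwd-ladder-Parity-50-0` (unit `fwd-ladder-Parity-50`, 2026-08-17).  The crux is the summit
conjunct in another language (`SummitEquivalence.polyMobiusTail_iff_batemanHorn`, p161759), so the ladder is
worked DOWN inside the crux's only live skeleton (v7.1 `Lines/stub_window_nonlinear.lean`: open stubs W2, W3,
S4a′, S4b, S2u; composition `CoreExact.polyMobiusTail_of_coreSmall`, p158707).

## The gradation and the rung

Gradation parameter: the NUMBER OF LINEAR MEMBERS `k` of the (parity-free) WINDOW piece of the Möbius tail,
localised to the CORNER `∃ i, dᵢ ≤ x^σ`.  Rung family `WindowLinearCorner k` (below).  Floor (PROVED, in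
tree): `k = 2` — `EtaFreeWindow.stub_pair_corner` (p146909; divisor switch + Bombieri–Vinogradov for `μ`,
`Literature.NumberTheory.Sieve.bombieriVinogradov_moebius`), certified here as `windowLinearCorner_two`
(no `sorry`).  NEXT RUNG = `stub_window_three_corner : WindowLinearCorner 3` — exactly one parameter moved.
Why the `k = 2` proof stops at `k = 3` (located): the third member contributes a modulus `d₃ ≤ x^σ` and CRT
classes `f₃(n) ≡ 0 (mod d₃)`; the remaining pair `(d₁, d₂)` runs over a pair window shifted down to
`d₁d₂ ∈ (x^{1-η}/d₃, x^{1+θ}/d₃]`, and the trivial sum over `d₃` with weight `|μ(d₃)| log d₃` costs `(σ log x)²/2`,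
so EVERY pair range (corner p146909, middle p148016, balanced p145202) must be redone UNIFORMLY in progressions
to moduli `≤ x^σ` with at least a `(log x)^{2+ε}` saving (BV/Siegel–Walfisz for `μ` in the double corner;
Linnik dispersion / Duke–Friedlander–Iwaniec bilinear Kloosterman fractions with one extra trivially-summed small
modulus in the middle and balanced boxes).  In print for `Λ` in the dominant sub-ranges (Fouvry–Shparlinski 2011,
Irving arXiv:1301.6372, Bourgain–Garaev arXiv:1211.4184 — uniformity in the modulus is their point); expected
theorem-grade, size L/XL (census gen 4 T12a(a), D19a, D20a).  `∃ σ > 0` (not `∀ σ < 1/3`): `σ + η` must stay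
below the pair window's admissible cut-off, and `σ` near `1/3` would need uniformity in `q ∼ x^{1/3}`.

## The skeleton (seven registered stubs; composition PROVED; concludes the crux BY NAME)

* NEW  `stub_window_three_corner`      — the RUNG (`WindowLinearCorner 3`; theorem-grade in expectation).
* NEW  `stub_window_three_interior`    — `WindowLinearInterior 3`: all `dᵢ > x^σ`, for EVERY `σ > 0` (the
  dominant boxes are divisor-switching + Kloosterman-fraction bilinear forms, in print for `Λ`; the balanced cube
  `dᵢ ∼ x^{1/3}` is the open engine `StrategistS1.TrilinearKloostermanFractionSaving` — Goldston–Yıldırım 2001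
  Thm 1.1 has only `O(R³)`, Blomer 2017 calls the `τ`-analogue an open problem).  OPEN.
* NEW  `stub_window_linear_four_le_uniform` — S2u restricted to `k ≥ 4` (open; the next rungs of the same ladder).
* W2 `stub_single_nonlinear_level`, W3 `stub_multi_nonlinear_level`, S4a′ `stub_large_core_small`,
  S4b `stub_large_band_three_le` — VERBATIM the v7.1 registered stubs (open problems in print; S4a′ is the
  parity core, `CoreExact.coreSmall_twin_iff`).
* PROVED here: `windowThreeUniform_of_corner_of_interior` (corner₃ ∧ interior₃ ⇒ the `k = 3` uniform window),
  `windowLinearThreeLeUniform_derived` (that ∧ four_le ⇒ S2u verbatim), `windowNonlinearUniform_derived`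
  (landed W1 p167211 ∧ W2 ∧ W3 ⇒ S3u, proof copied from v7.1), `PolyMobiusTail_of` (the crux BY NAME via
  `CoreExact.polyMobiusTail_of_coreSmall`), `PolyMobiusTail_of_isogenyRedei`, `batemanHorn_of_stubs`.

Checks recorded in the line card `Lines/window_three_corner.md`: `WindowLinearCorner 3 → PolyMobiusTail` and
`→ BatemanHorn` do NOT close (battery `exact? | simpa | aesop`); floor `WindowLinearCorner 2 → WindowLinearCorner 3`
does not close; `BatemanHorn → WindowLinearCorner 3` does not close either (the rung is a parity-free
localisation piece, consistent with the random model, not a formal consequence of the count asymptotic).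
Disproof used: `polyMobiusTail_false_without_nonAssoc` is honoured — every stub carries the full
`IsBatemanHornSystem` hypothesis; no stub is an instance of a landed Negative lemma (the window/corner pieces
have no main term).  FORWARD: generator=ladder; top_equivalence=
`Summit.Parity.BatemanHorn.Theorems.PolyMobiusTail.SummitEquivalence.polyMobiusTail_iff_batemanHorn`;
seed=g4b-Parity-0870; witness=`Summit.Parity.BatemanHorn.Theorems.PolyMobiusTail.EtaFreeWindow.stub_pair_corner`;
rung_of=stub_pair_corner (k = 2 linear corner); rung_decl=
`Summit.Parity.BatemanHorn.Cruxes.PolyMobiusTail.WindowThreeCorner.WindowLinearCorner` (at `3`);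
step=parameter: number of linear members k 2 → 3 (corner piece); disposition=frontier.
-/

open scoped BigOperators Topology
open Filter Finset Polynomial Asymptotics

namespace Summit.Parity.BatemanHorn.Cruxes.PolyMobiusTail.WindowThreeCorner

open Literature.NumberTheory.Sieve
open Summit.Parity.BatemanHorn.Theorems.PolyMobiusTail.EtaFreeWindow

/-! ## §0  The rung family and its proved floor -/

/-- **Rung family (gradation parameter `k` = number of linear members).**  `WindowLinearCorner k`: for every
Bateman–Horn system of `k` members of degree `≤ 1` there are `σ > 0` and `c > 0` such that for all
`θ, η ∈ (0, c]` the CORNER part (`∃ i, dᵢ ≤ x^σ`) of the window `x^{1-η} < ∏ dᵢ ≤ x^{1+θ}` of the Möbius tail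
`Σ_{n ≤ x} Σ_{dᵢ ∣ fᵢ(n)} ∏ μ(dᵢ) log dᵢ` is `o(x)`.  Floor `k = 2` proved (`windowLinearCorner_two`);
rung `k = 3` = `stub_window_three_corner`. -/
def WindowLinearCorner (k : ℕ) : Prop :=
  ∀ (f : Fin k → ℤ[X]), IsBatemanHornSystem f → (∀ i, (f i).natDegree ≤ 1) →
    ∃ σ : ℝ, 0 < σ ∧ ∃ c : ℝ, 0 < c ∧ ∀ θ η : ℝ, 0 < θ → θ ≤ c → 0 < η → η ≤ c →
      (fun x : ℕ => ∑ n ∈ Finset.Icc 1 x,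
        ∑ d ∈ Fintype.piFinset (fun i => (((f i).eval (n : ℤ)).toNat).divisors),
          if ((x : ℝ) ^ (1 - η) < ∏ i, (d i : ℝ) ∧ ∏ i, (d i : ℝ) ≤ (x : ℝ) ^ (1 + θ)) ∧
              (∃ i, (d i : ℝ) ≤ (x : ℝ) ^ σ) then
            ∏ i, ((ArithmeticFunction.moebius (d i) : ℝ) * Real.log (d i)) else 0)
        =o[atTop] fun x : ℕ => (x : ℝ)

/-- **Interior family.**  `WindowLinearInterior k`: for every Bateman–Horn system of `k` members of degree `≤ 1`
and EVERY `σ > 0` there is `c > 0` such that for all `θ, η ∈ (0, c]` the INTERIOR part (`∀ i, x^σ < dᵢ`) of the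
window is `o(x)`. -/
def WindowLinearInterior (k : ℕ) : Prop :=
  ∀ (f : Fin k → ℤ[X]), IsBatemanHornSystem f → (∀ i, (f i).natDegree ≤ 1) →
    ∀ σ : ℝ, 0 < σ → ∃ c : ℝ, 0 < c ∧ ∀ θ η : ℝ, 0 < θ → θ ≤ c → 0 < η → η ≤ c →
      (fun x : ℕ => ∑ n ∈ Finset.Icc 1 x,
        ∑ d ∈ Fintype.piFinset (fun i => (((f i).eval (n : ℤ)).toNat).divisors),
          if ((x : ℝ) ^ (1 - η) < ∏ i, (d i : ℝ) ∧ ∏ i, (d i : ℝ) ≤ (x : ℝ) ^ (1 + θ)) ∧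
              (∀ i, (x : ℝ) ^ σ < (d i : ℝ)) then
            ∏ i, ((ArithmeticFunction.moebius (d i) : ℝ) * Real.log (d i)) else 0)
        =o[atTop] fun x : ℕ => (x : ℝ)

/-- **The FLOOR of the ladder, certified (no `sorry`): `k = 2` is the landed `stub_pair_corner` (p146909)** at
`σ = 1/6` (`min(d₀, d₁) ≤ x^σ ↔ ∃ i, dᵢ ≤ x^σ` on `Fin 2`). -/
theorem windowLinearCorner_two : WindowLinearCorner 2 := by
  intro f hf hlin
  obtain ⟨c, hc, H⟩ := stub_pair_corner f hf hlin (1 / 6) (by norm_num) (by norm_num)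
  refine ⟨1 / 6, by norm_num, c, hc, fun θ η hθ hθc hη hηc => ?_⟩
  refine (H θ η hθ hθc hη hηc).congr_left fun x => ?_
  refine Finset.sum_congr rfl fun n _ => Finset.sum_congr rfl fun d _ => ?_
  simp only [Fin.exists_fin_two, Nat.cast_min, min_le_iff, and_assoc]

/-! ## §1  The seven registered stubs -/

/-- **R3 · `stub_window_three_corner` — THE RUNG (`WindowLinearCorner 3`; NEW; theorem-grade in expectation,
size L/XL).**  For a Bateman–Horn system of three members of degree `≤ 1` there are `σ > 0`, `c > 0` with the
corner part (`∃ i, dᵢ ≤ x^σ`) of the window `o(x)` for all `θ, η ∈ (0, c]`.  Plan: by symmetry take `d₃ ≤ x^σ`;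
fix `d₃` and the CRT classes `n ≡ ν (mod d₃)`, `f₃(ν) ≡ 0`; the pair `(d₁, d₂)` then runs over the pair window
`(x^{1-η}/d₃, x^{1+θ}/d₃]` restricted to a progression: (a) double corner `min(d₁,d₂) ≤ x^{σ'}` — switch the
large divisor to its cofactor, `μ · log` in progressions to moduli `≤ x^{2σ+2σ'+η}`, Bombieri–Vinogradov for `μ`
(`bombieriVinogradov_moebius`) with `τ₃`-weights; (b) middle / balanced boxes — the dispersion and bilinear
Kloosterman-fraction estimates of p148016 / p145202 carried uniformly in the extra modulus `d₃ ≤ x^σ`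
(Duke–Friedlander–Iwaniec 1997 `DukeFriedlanderIwaniec1997_determinant_holds`; Bettin–Chandee 2018); the trivial
`d₃`-sum costs `(σ log x)²`, every range has a log-power (indeed power) saving to spare once `σ` is small.
Why it might fail: hardness only — the uniformity of the balanced-pair main-term cancellation
(`PairBalancedMainTerm`) in progressions with `μ(d₃) log d₃` weights must save `(log x)^{2+ε}`; consistent with
the random model (no main term).  Sources: p146909, p148016, p145202, p148167 (`stub_window_linear_pair`);
Fouvry–Shparlinski 2011 Thm 5; Irving arXiv:1301.6372 §1; Bourgain–Garaev arXiv:1211.4184 Thms 9, 13;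
DukeFriedlanderIwaniec1997; BettinChandee2018; `Cruxes/PolyMobiusTail/STRATEGY-CENSUS.md` gen 4 T12a/D19a. -/
theorem stub_window_three_corner : ∀ (f : Fin 3 → ℤ[X]), IsBatemanHornSystem f →
    (∀ i, (f i).natDegree ≤ 1) →
    ∃ σ : ℝ, 0 < σ ∧ ∃ c : ℝ, 0 < c ∧ ∀ θ η : ℝ, 0 < θ → θ ≤ c → 0 < η → η ≤ c →
      (fun x : ℕ => ∑ n ∈ Finset.Icc 1 x,
        ∑ d ∈ Fintype.piFinset (fun i => (((f i).eval (n : ℤ)).toNat).divisors),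
          if ((x : ℝ) ^ (1 - η) < ∏ i, (d i : ℝ) ∧ ∏ i, (d i : ℝ) ≤ (x : ℝ) ^ (1 + θ)) ∧
              (∃ i, (d i : ℝ) ≤ (x : ℝ) ^ σ) then
            ∏ i, ((ArithmeticFunction.moebius (d i) : ℝ) * Real.log (d i)) else 0)
        =o[atTop] fun x : ℕ => (x : ℝ) := by
  sorry

/-- **I3 · `stub_window_three_interior` — the `k = 3` INTERIOR for every `σ > 0` (`WindowLinearInterior 3`;
NEW; OPEN).**  For a Bateman–Horn system of three members of degree `≤ 1` and every `σ > 0` there is `c > 0`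
with the interior part (`∀ i, x^σ < dᵢ`) of the window `o(x)` for all `θ, η ∈ (0, c]`.  After Poisson in `n`
the tuple `(d₁, d₂, d₃)` (pairwise coprime up to bounded `gcd`s fixed by the resultants) carries the phase
`e(ℓ(h₂·\overline{d₁d₃}/d₂ + h₃·\overline{d₁d₂}/d₃))`: DOMINANT boxes (one `dᵢ ≥ x^{1/3+κ}`) are bilinear
Kloosterman-fraction / divisor-switching sums of the kind bounded for `Λ` by Fouvry–Shparlinski, Irving,
Bourgain–Garaev (port `Λ → μ` via Vaughan); the BALANCED cube `dᵢ ∼ x^{1/3}` sits at the Pólya–Vinogradov /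
completion threshold and needs the open `StrategistS1.TrilinearKloostermanFractionSaving` (census gen 4 S12a).
Why it might fail: hardness, not falsity — Goldston–Yıldırım 2001 (arXiv:math/0111212, Thm 1.1 and p. 5) reach
only `O(R³)` for the `Λ_R` triple correlation, Blomer (arXiv:1512.03278, p. 3) calls the `τ` triple correlation
"an extremely interesting and challenging open problem"; consistent with the random model.  Size XL / open.
Sources: arXiv:math/0111212 Thm 1.1; arXiv:1512.03278 §1; arXiv:1301.6372; arXiv:1211.4184;
DukeFriedlanderIwaniec1997; BettinChandee2018; `Cruxes/PolyMobiusTail/StrategistS1Sketch.lean` §S12. -/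
theorem stub_window_three_interior : ∀ (f : Fin 3 → ℤ[X]), IsBatemanHornSystem f →
    (∀ i, (f i).natDegree ≤ 1) →
    ∀ σ : ℝ, 0 < σ → ∃ c : ℝ, 0 < c ∧ ∀ θ η : ℝ, 0 < θ → θ ≤ c → 0 < η → η ≤ c →
      (fun x : ℕ => ∑ n ∈ Finset.Icc 1 x,
        ∑ d ∈ Fintype.piFinset (fun i => (((f i).eval (n : ℤ)).toNat).divisors),
          if ((x : ℝ) ^ (1 - η) < ∏ i, (d i : ℝ) ∧ ∏ i, (d i : ℝ) ≤ (x : ℝ) ^ (1 + θ)) ∧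
              (∀ i, (x : ℝ) ^ σ < (d i : ℝ)) then
            ∏ i, ((ArithmeticFunction.moebius (d i) : ℝ) * Real.log (d i)) else 0)
        =o[atTop] fun x : ℕ => (x : ℝ) := by
  sorry

/-- **S2u≥4 · `stub_window_linear_four_le_uniform` — the uniform linear window for `k ≥ 4` members (the
registered S2u restricted to `k ≥ 4`; OPEN; the higher rungs of the same ladder).**  For a Bateman–Horn system
of `k ≥ 4` members of degree `≤ 1` there is `c ∈ (0,1)` with the window `o(x)` for all `θ, η ∈ (0, c]`.  Its
corner contains the `(k-1)`-interior, so it is at least as hard as I3; no correlation of `k ≥ 4` divisor-type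
sums with a power saving is in print (Goldston–Graham–Pintz–Yıldırım arXiv:math/0506067 treat all `k` without
one).  Why it might fail: hardness, not falsity (random model).  Size XL / open.  Sources: arXiv:math/0111212 p. 5;
arXiv:math/0506067; DukeFriedlanderIwaniec1997; `Cruxes/PolyMobiusTail/STRATEGY-CENSUS.md` gen 4 S12a. -/
theorem stub_window_linear_four_le_uniform : ∀ (k : ℕ) (f : Fin k → ℤ[X]), IsBatemanHornSystem f →
    4 ≤ k → (∀ i, (f i).natDegree ≤ 1) →
    ∃ c : ℝ, 0 < c ∧ c < 1 ∧ ∀ θ η : ℝ, 0 < θ → θ ≤ c → 0 < η → η ≤ c →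
      (fun x : ℕ => ∑ n ∈ Finset.Icc 1 x,
        ∑ d ∈ Fintype.piFinset (fun i => (((f i).eval (n : ℤ)).toNat).divisors),
          if (x : ℝ) ^ (1 - η) < ∏ i, (d i : ℝ) ∧ ∏ i, (d i : ℝ) ≤ (x : ℝ) ^ (1 + θ) then
            ∏ i, ((ArithmeticFunction.moebius (d i) : ℝ) * Real.log (d i)) else 0)
        =o[atTop] fun x : ℕ => (x : ℝ) := by
  sorry

/-- **W2 · `stub_single_nonlinear_level` — VERBATIM the v7.1 registered stub (ENGINE for ONE polynomial of
degree `≥ 2`; open).**  The μ-twisted signed level of distribution of the roots of `f₀` at moduli `d ≍ x^{1±c}`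
with a log-power saving, in the `Fin 1`-tuple form consumed by the landed W1
(`NonlinearWindow.stub_nonlinear_window_of_level`, p167211).  Why it might fail: hardness — any quantitative
root equidistribution beyond Duke–Friedlander–Iwaniec 1995 / Tóth 2000 is open even for `X²+1`; for cubics even
the qualitative prime-modulus statement is open (Hooley 1964).  Size XL / open.  Sources: DukeFriedlanderIwaniec1995,
Toth2000, Hooley1964, DukeFriedlanderIwaniec1997, BettinChandee2018, route GaussianFractions items 12214/12215. -/
theorem stub_single_nonlinear_level : ∀ (f : Fin 1 → ℤ[X]), IsBatemanHornSystem f → 2 ≤ (f 0).natDegree →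
    ∃ c : ℝ, 0 < c ∧ ∃ A : ℝ, 1 < A ∧ ∃ x₀ : ℝ, ∀ x D D' : ℝ, x₀ ≤ x → x ^ (1 - c) ≤ D → D ≤ D' →
      D' ≤ 2 * D → D ≤ x ^ (1 + c) →
      |∑ d ∈ Fintype.piFinset (fun _ : Fin 1 => Finset.Icc 1 ⌊D'⌋₊),
          (if D < ∏ i, (d i : ℝ) ∧ ∏ i, (d i : ℝ) ≤ D' then
            (∏ i, ((ArithmeticFunction.moebius (d i) : ℝ) * Real.log (d i))) *
              (((((Finset.Icc 1 ⌊x⌋₊).filter (fun n : ℕ =>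
                  ∀ i, d i ∈ (((f i).eval (n : ℤ)).toNat).divisors)).card : ℕ) : ℝ) -
                x * Summit.Parity.BatemanHorn.Theorems.TypeIMainTerm.sysDensity f d)
          else 0)| ≤ x / Real.log x ^ A := by
  sorry

/-- **W3 · `stub_multi_nonlinear_level` — VERBATIM the v7.1 registered stub (ENGINE for `k ≥ 2` members, one of
degree `≥ 2`; open, tool-less).**  The `∏ μ log`-weighted signed level of distribution of the CRT-entangled
simultaneous root counts at the diagonal `∏ dᵢ ≍ x^{1±c}` with a log-power saving.  Why it might fail: hardness,
not falsity (random model; implied slice-wise by Λ-Bateman–Horn + core + band, `Negative.Equivalence`).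
Size XL / open.  Sources: DukeFriedlanderIwaniec1997, arXiv:2008.09905 §1.3, `Cruxes/PolyMobiusTail/STRATEGY-CENSUS.md`
gen 4, `Cruxes/PolyMobiusTail/BarrierNotesIdeator4.md` §B20. -/
theorem stub_multi_nonlinear_level : ∀ (k : ℕ) (f : Fin k → ℤ[X]), IsBatemanHornSystem f → 2 ≤ k →
    (∃ i, 2 ≤ (f i).natDegree) →
    ∃ c : ℝ, 0 < c ∧ ∃ A : ℝ, 1 < A ∧ ∃ x₀ : ℝ, ∀ x D D' : ℝ, x₀ ≤ x → x ^ (1 - c) ≤ D → D ≤ D' →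
      D' ≤ 2 * D → D ≤ x ^ (1 + c) →
      |∑ d ∈ Fintype.piFinset (fun _ : Fin k => Finset.Icc 1 ⌊D'⌋₊),
          (if D < ∏ i, (d i : ℝ) ∧ ∏ i, (d i : ℝ) ≤ D' then
            (∏ i, ((ArithmeticFunction.moebius (d i) : ℝ) * Real.log (d i))) *
              (((((Finset.Icc 1 ⌊x⌋₊).filter (fun n : ℕ =>
                  ∀ i, d i ∈ (((f i).eval (n : ℤ)).toNat).divisors)).card : ℕ) : ℝ) -
                x * Summit.Parity.BatemanHorn.Theorems.TypeIMainTerm.sysDensity f d)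
          else 0)| ≤ x / Real.log x ^ A := by
  sorry

/-- **S4a′ · `stub_large_core_small` — VERBATIM the v7.1 registered stub (the EXACT parity core; open; every
system).**  For every Bateman–Horn system there is `θ₀ ∈ (0,1)` such that for `0 < θ ≤ θ₀`, `0 < δ < θ` the
cofactor-large part of the Möbius tail on complete pencils is `o(x)`.  Exact strength (landed): on a linear pair
⟺ the pair's Λ-Hardy–Littlewood asymptotic (`CoreExact.coreSmall_iff_lambda_pair`, `coreSmall_twin_iff`).
Why it might fail: only if Bateman–Horn fails; the risk is hardness (Selberg/Bombieri parity indeterminacy: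
`Literature.Barriers.Parity.SelbergParityBarrier`).  Size XL (summit-in-kind).  Sources: BombieriAsymptoticSieve1976;
Ford2005; arXiv:2008.09905 §1.3; `Cruxes/PolyMobiusTail/STRATEGY-CENSUS.md` gen 4 D20. -/
theorem stub_large_core_small : ∀ (k : ℕ) (f : Fin k → ℤ[X]), IsBatemanHornSystem f →
    ∃ θ₀ : ℝ, 0 < θ₀ ∧ θ₀ < 1 ∧ ∀ θ δ : ℝ, 0 < θ → θ ≤ θ₀ → 0 < δ → δ < θ →
      (fun x : ℕ => ∑ n ∈ Finset.Icc 1 x,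
        ∑ e ∈ Fintype.piFinset (fun i => (((f i).eval (n : ℤ)).toNat).divisors),
          if (x : ℝ) ^ (1 + θ) < ∏ i, ((((f i).eval (n : ℤ)).toNat / e i : ℕ) : ℝ) ∧
              ∏ i, (e i : ℝ) ≤ (x : ℝ) ^ (1 - δ) then
            ∏ i, ((ArithmeticFunction.moebius (((f i).eval (n : ℤ)).toNat / e i) : ℝ) *
              Real.log ((((f i).eval (n : ℤ)).toNat / e i : ℕ) : ℝ)) else 0)
        =o[atTop] fun x : ℕ => (x : ℝ) := by
  sorry

/-- **S4b · `stub_large_band_three_le` — VERBATIM the v7.1 registered stub (the HYPER-INCOMPLETE BAND, total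
degree `G ≥ 3`; open, parity-free in kind).**  For every Bateman–Horn system with `∑ deg fᵢ ≥ 3` and
`0 < δ < θ < 1` the part of the Möbius tail with `∏ fᵢ(n)/eᵢ > x^{1+θ}` and `∏ eᵢ > x^{1-δ}` is `o(x)`.  Open with
`μ ↦ 1` already (divisor correlations at the Pólya–Vinogradov threshold, Blomer 2017); empty for `G ≤ 2` (p154483).
Why it might fail: hardness, not falsity (no main term in the random model).  Size L/XL.  Sources: Blomer2017;
census gen 4 D20 / T12; arXiv:2008.09905 §1.3. -/
theorem stub_large_band_three_le : ∀ (k : ℕ) (f : Fin k → ℤ[X]), IsBatemanHornSystem f →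
    3 ≤ ∑ i, (f i).natDegree → ∀ θ δ : ℝ, 0 < θ → θ < 1 → 0 < δ → δ < θ →
    (fun x : ℕ => ∑ n ∈ Finset.Icc 1 x,
      ∑ e ∈ Fintype.piFinset (fun i => (((f i).eval (n : ℤ)).toNat).divisors),
        if (x : ℝ) ^ (1 + θ) < ∏ i, ((((f i).eval (n : ℤ)).toNat / e i : ℕ) : ℝ) ∧
            (x : ℝ) ^ (1 - δ) < ∏ i, (e i : ℝ) then
          ∏ i, ((ArithmeticFunction.moebius (((f i).eval (n : ℤ)).toNat / e i) : ℝ) *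
            Real.log ((((f i).eval (n : ℤ)).toNat / e i : ℕ) : ℝ)) else 0)
      =o[atTop] fun x : ℕ => (x : ℝ) := by
  sorry

/-! ## §2  Compositions (all PROVED) -/

/-- Book-keeping: the rung stub is literally `WindowLinearCorner 3`, the interior stub `WindowLinearInterior 3`. -/
theorem windowLinearCorner_three : WindowLinearCorner 3 := stub_window_three_corner
theorem windowLinearInterior_three : WindowLinearInterior 3 := stub_window_three_interior

/-- **Corner₃ ∧ Interior₃ ⇒ the `k = 3` uniform linear window** (the `k = 3` case of S2u).  Take the corner's
`σ`, feed it to the interior, shrink `c` to `min(c₁, c₂, 1/2)` and add the two localised sums pointwise. -/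
theorem windowThreeUniform_of_corner_of_interior (hC : WindowLinearCorner 3) (hI : WindowLinearInterior 3) :
    ∀ (f : Fin 3 → ℤ[X]), IsBatemanHornSystem f → (∀ i, (f i).natDegree ≤ 1) →
      ∃ c : ℝ, 0 < c ∧ c < 1 ∧ ∀ θ η : ℝ, 0 < θ → θ ≤ c → 0 < η → η ≤ c →
        (fun x : ℕ => ∑ n ∈ Finset.Icc 1 x,
          ∑ d ∈ Fintype.piFinset (fun i => (((f i).eval (n : ℤ)).toNat).divisors),
            if (x : ℝ) ^ (1 - η) < ∏ i, (d i : ℝ) ∧ ∏ i, (d i : ℝ) ≤ (x : ℝ) ^ (1 + θ) then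
              ∏ i, ((ArithmeticFunction.moebius (d i) : ℝ) * Real.log (d i)) else 0)
          =o[atTop] fun x : ℕ => (x : ℝ) := by
  intro f hf hlin
  obtain ⟨σ, hσ, c₁, hc₁, hC'⟩ := hC f hf hlin
  obtain ⟨c₂, hc₂, hI'⟩ := hI f hf hlin σ hσ
  set c : ℝ := min (min c₁ c₂) (1 / 2) with hc
  have hc0 : 0 < c := lt_min (lt_min hc₁ hc₂) (by norm_num)
  have hcle1 : c ≤ c₁ := (min_le_left _ _).trans (min_le_left _ _)
  have hcle2 : c ≤ c₂ := (min_le_left _ _).trans (min_le_right _ _)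
  have hclt : c < 1 := (min_le_right _ _).trans_lt (by norm_num)
  refine ⟨c, hc0, hclt, fun θ η hθ hθc hη hηc => ?_⟩
  have h1 := hC' θ η hθ (hθc.trans hcle1) hη (hηc.trans hcle1)
  have h2 := hI' θ η hθ (hθc.trans hcle2) hη (hηc.trans hcle2)
  refine (h1.add h2).congr_left fun x => ?_
  try dsimp only
  rw [← Finset.sum_add_distrib]
  refine Finset.sum_congr rfl fun n _ => ?_
  rw [← Finset.sum_add_distrib]
  refine Finset.sum_congr rfl fun d _ => ?_
  by_cases hW : ((x : ℝ) ^ (1 - η) < ∏ i, (d i : ℝ) ∧ ∏ i, (d i : ℝ) ≤ (x : ℝ) ^ (1 + θ))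
  · by_cases hcor : ∃ i, (d i : ℝ) ≤ (x : ℝ) ^ σ
    · have hni : ¬ ∀ i, (x : ℝ) ^ σ < (d i : ℝ) := by
        push Not
        exact hcor
      simp [hW, hcor, hni]
    · have hi : ∀ i, (x : ℝ) ^ σ < (d i : ℝ) := by
        push Not at hcor
        exact hcor
      simp [hW, hcor, hi]
  · simp [hW]

/-- **S2u `stub_window_linear_three_le_uniform` (v7.1 registered signature VERBATIM), DERIVED** from the `k = 3`
window and the `k ≥ 4` stub by cases on `k`. -/
theorem windowLinearThreeLeUniform_derived : ∀ (k : ℕ) (f : Fin k → ℤ[X]), IsBatemanHornSystem f →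
    3 ≤ k → (∀ i, (f i).natDegree ≤ 1) →
    ∃ c : ℝ, 0 < c ∧ c < 1 ∧ ∀ θ η : ℝ, 0 < θ → θ ≤ c → 0 < η → η ≤ c →
      (fun x : ℕ => ∑ n ∈ Finset.Icc 1 x,
        ∑ d ∈ Fintype.piFinset (fun i => (((f i).eval (n : ℤ)).toNat).divisors),
          if (x : ℝ) ^ (1 - η) < ∏ i, (d i : ℝ) ∧ ∏ i, (d i : ℝ) ≤ (x : ℝ) ^ (1 + θ) then
            ∏ i, ((ArithmeticFunction.moebius (d i) : ℝ) * Real.log (d i)) else 0)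
        =o[atTop] fun x : ℕ => (x : ℝ) := by
  intro k f hf hk hlin
  by_cases hk3 : k = 3
  · subst hk3
    exact windowThreeUniform_of_corner_of_interior windowLinearCorner_three windowLinearInterior_three f hf hlin
  · exact stub_window_linear_four_le_uniform k f hf (by omega) hlin

/-- **S3u `stub_window_nonlinear_uniform`, DERIVED** from the LANDED W1 (`NonlinearWindow.stub_nonlinear_window_of_level`,
p167211) and the stubs W2, W3 — the v7.1 composition `WindowNonlinearUniform_of`, copied (cases `k = 0` vacuous,
`k = 1` via W2, `k ≥ 2` via W3). -/
theorem windowNonlinearUniform_derived : ∀ (k : ℕ) (f : Fin k → ℤ[X]), IsBatemanHornSystem f →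
    (∃ i, 2 ≤ (f i).natDegree) →
    ∃ c : ℝ, 0 < c ∧ c < 1 ∧ ∀ θ η : ℝ, 0 < θ → θ ≤ c → 0 < η → η ≤ c →
      (fun x : ℕ => ∑ n ∈ Finset.Icc 1 x,
        ∑ d ∈ Fintype.piFinset (fun i => (((f i).eval (n : ℤ)).toNat).divisors),
          if (x : ℝ) ^ (1 - η) < ∏ i, (d i : ℝ) ∧ ∏ i, (d i : ℝ) ≤ (x : ℝ) ^ (1 + θ) then
            ∏ i, ((ArithmeticFunction.moebius (d i) : ℝ) * Real.log (d i)) else 0)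
        =o[atTop] fun x : ℕ => (x : ℝ) := by
  intro k f hf hi
  by_cases hk : 2 ≤ k
  · exact Summit.Parity.BatemanHorn.Theorems.PolyMobiusTail.NonlinearWindow.stub_nonlinear_window_of_level
      k f hf hi (stub_multi_nonlinear_level k f hf hk hi)
  · obtain ⟨i, hi⟩ := hi
    have hk' : k = 0 ∨ k = 1 := by omega
    rcases hk' with rfl | rfl
    · exact i.elim0
    · have h0 : 2 ≤ (f 0).natDegree := by
        have hi0 : i = 0 := Fin.fin_one_eq_zero i
        rw [hi0] at hi
        exact hi
      exact Summit.Parity.BatemanHorn.Theorems.PolyMobiusTail.NonlinearWindow.stub_nonlinear_window_of_level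
        1 f hf ⟨0, h0⟩ (stub_single_nonlinear_level f hf h0)

/-- **Composition of the crux (PROVED modulo the seven registered stubs): the crux of route PolynomialMobius,
BY NAME**, via the landed `CoreExact.polyMobiusTail_of_coreSmall` (p158707). -/
theorem PolyMobiusTail_of : Summit.Parity.BatemanHorn.Theses.PolynomialMobius.PolyMobiusTail :=
  CoreExact.polyMobiusTail_of_coreSmall stub_large_core_small stub_large_band_three_le
    windowLinearThreeLeUniform_derived windowNonlinearUniform_derived

/-- The identical decl of route IsogenyRedei (verbatim also CyclotomicTower / CrossedSalie / GaussianFractions). -/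
theorem PolyMobiusTail_of_isogenyRedei : Summit.Parity.BatemanHorn.Theses.IsogenyRedei.PolyMobiusTail :=
  PolyMobiusTail_of

/-- **The seven stubs prove the SUMMIT conjunct `BatemanHorn`** (certificate p161759). -/
theorem batemanHorn_of_stubs : _root_.BatemanHorn :=
  Summit.Parity.BatemanHorn.Theorems.PolyMobiusTail.SummitEquivalence.polyMobiusTail_iff_batemanHorn.mp
    PolyMobiusTail_of

/-- **The ladder, as one implication with the stubs as hypotheses** (rung first):
`WindowLinearCorner 3 → WindowLinearInterior 3 → S2u(k ≥ 4) → W2 → W3 → S4a′ → S4b → PolyMobiusTail`. -/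
theorem PolyMobiusTail_of_rung
    (hR : WindowLinearCorner 3) (hI : WindowLinearInterior 3)
    (h4 : ∀ (k : ℕ) (f : Fin k → ℤ[X]), IsBatemanHornSystem f → 4 ≤ k → (∀ i, (f i).natDegree ≤ 1) →
      ∃ c : ℝ, 0 < c ∧ c < 1 ∧ ∀ θ η : ℝ, 0 < θ → θ ≤ c → 0 < η → η ≤ c →
        (fun x : ℕ => ∑ n ∈ Finset.Icc 1 x,
          ∑ d ∈ Fintype.piFinset (fun i => (((f i).eval (n : ℤ)).toNat).divisors),
            if (x : ℝ) ^ (1 - η) < ∏ i, (d i : ℝ) ∧ ∏ i, (d i : ℝ) ≤ (x : ℝ) ^ (1 + θ) then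
              ∏ i, ((ArithmeticFunction.moebius (d i) : ℝ) * Real.log (d i)) else 0)
          =o[atTop] fun x : ℕ => (x : ℝ))
    (hW2 : ∀ (f : Fin 1 → ℤ[X]), IsBatemanHornSystem f → 2 ≤ (f 0).natDegree →
      ∃ c : ℝ, 0 < c ∧ ∃ A : ℝ, 1 < A ∧ ∃ x₀ : ℝ, ∀ x D D' : ℝ, x₀ ≤ x → x ^ (1 - c) ≤ D → D ≤ D' →
        D' ≤ 2 * D → D ≤ x ^ (1 + c) →
        |∑ d ∈ Fintype.piFinset (fun _ : Fin 1 => Finset.Icc 1 ⌊D'⌋₊),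
            (if D < ∏ i, (d i : ℝ) ∧ ∏ i, (d i : ℝ) ≤ D' then
              (∏ i, ((ArithmeticFunction.moebius (d i) : ℝ) * Real.log (d i))) *
                (((((Finset.Icc 1 ⌊x⌋₊).filter (fun n : ℕ =>
                    ∀ i, d i ∈ (((f i).eval (n : ℤ)).toNat).divisors)).card : ℕ) : ℝ) -
                  x * Summit.Parity.BatemanHorn.Theorems.TypeIMainTerm.sysDensity f d)
            else 0)| ≤ x / Real.log x ^ A)
    (hW3 : ∀ (k : ℕ) (f : Fin k → ℤ[X]), IsBatemanHornSystem f → 2 ≤ k →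
      (∃ i, 2 ≤ (f i).natDegree) →
      ∃ c : ℝ, 0 < c ∧ ∃ A : ℝ, 1 < A ∧ ∃ x₀ : ℝ, ∀ x D D' : ℝ, x₀ ≤ x → x ^ (1 - c) ≤ D → D ≤ D' →
        D' ≤ 2 * D → D ≤ x ^ (1 + c) →
        |∑ d ∈ Fintype.piFinset (fun _ : Fin k => Finset.Icc 1 ⌊D'⌋₊),
            (if D < ∏ i, (d i : ℝ) ∧ ∏ i, (d i : ℝ) ≤ D' then
              (∏ i, ((ArithmeticFunction.moebius (d i) : ℝ) * Real.log (d i))) *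
                (((((Finset.Icc 1 ⌊x⌋₊).filter (fun n : ℕ =>
                    ∀ i, d i ∈ (((f i).eval (n : ℤ)).toNat).divisors)).card : ℕ) : ℝ) -
                  x * Summit.Parity.BatemanHorn.Theorems.TypeIMainTerm.sysDensity f d)
            else 0)| ≤ x / Real.log x ^ A)
    (hCore : ∀ (k : ℕ) (f : Fin k → ℤ[X]), IsBatemanHornSystem f →
      ∃ θ₀ : ℝ, 0 < θ₀ ∧ θ₀ < 1 ∧ ∀ θ δ : ℝ, 0 < θ → θ ≤ θ₀ → 0 < δ → δ < θ →
      (fun x : ℕ => ∑ n ∈ Finset.Icc 1 x,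
        ∑ e ∈ Fintype.piFinset (fun i => (((f i).eval (n : ℤ)).toNat).divisors),
          if (x : ℝ) ^ (1 + θ) < ∏ i, ((((f i).eval (n : ℤ)).toNat / e i : ℕ) : ℝ) ∧
              ∏ i, (e i : ℝ) ≤ (x : ℝ) ^ (1 - δ) then
            ∏ i, ((ArithmeticFunction.moebius (((f i).eval (n : ℤ)).toNat / e i) : ℝ) *
              Real.log ((((f i).eval (n : ℤ)).toNat / e i : ℕ) : ℝ)) else 0)
        =o[atTop] fun x : ℕ => (x : ℝ))
    (hBand : ∀ (k : ℕ) (f : Fin k → ℤ[X]), IsBatemanHornSystem f →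
      3 ≤ ∑ i, (f i).natDegree → ∀ θ δ : ℝ, 0 < θ → θ < 1 → 0 < δ → δ < θ →
      (fun x : ℕ => ∑ n ∈ Finset.Icc 1 x,
        ∑ e ∈ Fintype.piFinset (fun i => (((f i).eval (n : ℤ)).toNat).divisors),
          if (x : ℝ) ^ (1 + θ) < ∏ i, ((((f i).eval (n : ℤ)).toNat / e i : ℕ) : ℝ) ∧
              (x : ℝ) ^ (1 - δ) < ∏ i, (e i : ℝ) then
            ∏ i, ((ArithmeticFunction.moebius (((f i).eval (n : ℤ)).toNat / e i) : ℝ) *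
              Real.log ((((f i).eval (n : ℤ)).toNat / e i : ℕ) : ℝ)) else 0)
        =o[atTop] fun x : ℕ => (x : ℝ)) :
    Summit.Parity.BatemanHorn.Theses.PolynomialMobius.PolyMobiusTail := by
  refine CoreExact.polyMobiusTail_of_coreSmall hCore hBand ?_ ?_
  · intro k f hf hk hlin
    by_cases hk3 : k = 3
    · subst hk3
      exact windowThreeUniform_of_corner_of_interior hR hI f hf hlin
    · exact h4 k f hf (by omega) hlin
  · intro k f hf hi
    by_cases hk : 2 ≤ k
    · exact Summit.Parity.BatemanHorn.Theorems.PolyMobiusTail.NonlinearWindow.stub_nonlinear_window_of_level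
        k f hf hi (hW3 k f hf hk hi)
    · obtain ⟨i, hi⟩ := hi
      have hk' : k = 0 ∨ k = 1 := by omega
      rcases hk' with rfl | rfl
      · exact i.elim0
      · have h0 : 2 ≤ (f 0).natDegree := by
          have hi0 : i = 0 := Fin.fin_one_eq_zero i
          rw [hi0] at hi
          exact hi
        exact Summit.Parity.BatemanHorn.Theorems.PolyMobiusTail.NonlinearWindow.stub_nonlinear_window_of_level
          1 f hf ⟨0, h0⟩ (hW2 f hf h0)

end Summit.Parity.BatemanHorn.Cruxes.PolyMobiusTail.WindowThreeCorner
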